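import Summits.FinalStateConjecture.FinalStateConjecture.Theorems.PhotonSphereChannelsChannelsResolveTameDevelopmentsRWeightedTransport
import Summits.FinalStateConjecture.FinalStateConjecture.Theorems.PhotonSphereChannelsChannelsResolveTameDevelopmentsRWeightedEstimate
import Summits.FinalStateConjecture.FinalStateConjecture.Theorems.PhotonSphereChannelsChannelsResolveTameDevelopmentsRPotentialRepulsion
import Summits.FinalStateConjecture.FinalStateConjecture.Theorems.PhotonSphereChannelsChannelsResolveTameDevelopmentsRExhaustion

/-!
# Route PhotonSphereChannels — outgoing-energy exhaustion for compactly supported Regge–Wheeler data from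
# integrated local energy decay (sub-goal `stub_compactExhaustionOfLocalDecay` of H4)

Line `isolated-kerr-connected-hull`, crux stmt-FinalStateConjecture-14075, stub H4
(`stub_outgoingEnergyExhaustion`).  We prove the registered implication
`RWLocalEnergyDecay → CompactDataExhaustion`: for `M > 0`, a tortoise radius function `r` with the photon
sphere at `xc`, `s ≤ 2`, `s ≤ ℓ`, and a global `C²` Regge–Wheeler solution `ψ` with compactly supported
Cauchy data, the forward channel energy of `ψ(B + ·)` through the bare light cone about `xc` tends to the
total energy as `B → +∞`, PROVIDED integrated local energy decay on compact tortoise intervals (the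
hypothesis, in its registered form) holds.

Proof.  The weighted transport identity (`…RWeightedTransport`) with the repulsive weights of
`…RPotentialRepulsion` (`w = r − 3M` on `x ≥ xc`, `κ = 1`; `w = xc − x` on `x ≤ xc`, `κ = −1`), closed by
finite speed of propagation (the solution vanishes beyond `|x| ≳ T`) and the weighted box estimate
(`…RWeightedEstimate`) fed with the local `L²` bound from the hypothesis, bounds the space-time integrals
of `(ψ_t ± ψ_x)² + Vψ²` over the two quadrants uniformly (`RW.quadrantBound_right/left`); the exhaustion
then follows from `RW.tendsto_channelEnergy_shift_of_quadrantBounds` (`…RExhaustion`) — the simplest `1+1`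
instance of the Dafermos–Rodnianski `r^p` multiplier method.  No definitions. [folklore]
-/

namespace Summit.FinalStateConjecture.FinalStateConjecture.Theorems

-- every `Summit.FinalStateConjecture.FinalStateConjecture.…` name repeats the summit = sub-problem
-- segment (D-0017 layout), as in every landed `…Theorems` file of this route
set_option linter.dupNamespace false

open MeasureTheory Set Filter Topology intervalIntegral
open Literature.Geometry.Lorentzian Literature.Geometry.Lorentzian.ReggeWheeler

noncomputable section

namespace RW

variable {M : ℝ} {r : ℝ → ℝ} {xc : ℝ} {s ℓ : ℕ}

/-- Data of a `C²` curried function supported in `[a, b]` vanish, together with the time derivative in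
Fréchet form, to the right of `b + 1` and to the left of `a − 1`. -/
private theorem data_zero {ψ : ℝ → ℝ → ℝ} (hU : ContDiff ℝ 2 (Function.uncurry ψ)) {a b : ℝ}
    (hdata : CauchyDataSupportedOn ψ (Icc a b)) :
    (∀ y, b + 1 ≤ y → Function.uncurry ψ (0, y) = 0) ∧
    (∀ y, b + 1 ≤ y → fderiv ℝ (Function.uncurry ψ) (0, y) (1, 0) = 0) ∧
    (∀ y, y ≤ a - 1 → Function.uncurry ψ (0, y) = 0) ∧
    (∀ y, y ≤ a - 1 → fderiv ℝ (Function.uncurry ψ) (0, y) (1, 0) = 0) := by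
  have hR : ∀ y, b + 1 ≤ y → y ∉ Icc a b := fun y hy h ↦ by linarith [h.2]
  have hL : ∀ y, y ≤ a - 1 → y ∉ Icc a b := fun y hy h ↦ by linarith [h.1]
  refine ⟨fun y hy ↦ (hdata y (hR y hy)).1, fun y hy ↦ ?_, fun y hy ↦ (hdata y (hL y hy)).1,
    fun y hy ↦ ?_⟩
  · rw [← WaveEnergy.deriv_slice_fst_eq hU]
    exact (hdata y (hR y hy)).2
  · rw [← WaveEnergy.deriv_slice_fst_eq hU]
    exact (hdata y (hL y hy)).2

/-- **Right quadrant bound.** Along a tortoise radius function (`s ≤ 2`, `s ≤ ℓ`) there is `ρ > 0` such that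
for every global `C²` Regge–Wheeler solution with Cauchy data supported in `[a, b] ∋ xc` whose local `L²`
mass on `[0, T] × [xc − ρ, xc + ρ]` is bounded by `K` uniformly in `T ≥ 0`, the space-time integral of the
incoming null energy `(ψ_t + ψ_x)² + Vψ²` over `[0, T] × [xc, R]` is bounded uniformly in `T ≥ 0`, `R ≥ xc`
(weight `r − 3M`). [folklore] -/
theorem quadrantBound_right (hr : IsTortoiseRadius M r xc) (hs : s ≤ 2) (hsℓ : s ≤ ℓ) :
    ∃ ρ : ℝ, 0 < ρ ∧ ∀ ψ : ℝ → ℝ → ℝ, IsRWSolution M s ℓ r ψ → ∀ a b : ℝ, a ≤ xc → xc ≤ b →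
      CauchyDataSupportedOn ψ (Icc a b) → ∀ K : ℝ,
      (∀ T, 0 ≤ T → (∫ t in (0 : ℝ)..T, ∫ x in (xc - ρ)..(xc + ρ), ψ t x ^ 2) ≤ K) →
      ∃ Q : ℝ, ∀ T, 0 ≤ T → ∀ R, xc ≤ R → (∫ t in (0 : ℝ)..T, ∫ x in xc..R,
        ((fderiv ℝ (Function.uncurry ψ) (t, x) (1, 0)
            + 1 * fderiv ℝ (Function.uncurry ψ) (t, x) (0, 1)) ^ 2
          + linePotential M s ℓ r x * Function.uncurry ψ (t, x) ^ 2)) ≤ Q := by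
  have hM := hr.mass_pos
  obtain ⟨x₁, C, hx₁, hC, hfar, hnear⟩ := linePotential_repulsive_right hr hs hsℓ
  refine ⟨x₁ - xc, by linarith, fun ψ hψ a b ha hb hdata K hK ↦ ?_⟩
  set V := linePotential M s ℓ r with hV
  set U := Function.uncurry ψ with hUdef
  have hV1 : ContDiff ℝ 1 V := contDiff_one_linePotential hr s ℓ
  have hVd : Differentiable ℝ V := differentiable_linePotential hr s ℓ
  have hV0 : ∀ x, 0 ≤ V x := fun x ↦ (linePotential_pos hr hsℓ x).le
  have hU : ContDiff ℝ 2 U := hψ.1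
  have hsol : ∀ z : ℝ × ℝ, fderiv ℝ (fderiv ℝ U) z (1, 0) (1, 0)
      - fderiv ℝ (fderiv ℝ U) z (0, 1) (0, 1) + V z.2 * U z = 0 := by
    rintro ⟨t, x⟩
    rw [← WaveEnergy.iteratedDeriv_two_slice_fst_eq hU, ← WaveEnergy.iteratedDeriv_two_slice_snd_eq hU]
    exact hψ.2 (t, x)
  obtain ⟨h0R, h1R, -, -⟩ := data_zero hU hdata
  have hzero := fun (τ y : ℝ) (hy : b + 1 + |τ| ≤ y) (v : ℝ × ℝ) ↦
    WaveEnergy.eq_zero_right_of_data hU hVd hV0 hsol h0R h1R hy v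
  -- densities and weight
  set e1 : ℝ × ℝ → ℝ := fun z ↦ (fderiv ℝ U z (1, 0) + 1 * fderiv ℝ U z (0, 1)) ^ 2 + V z.2 * U z ^ 2
    with he1
  set p1 : ℝ × ℝ → ℝ := fun z ↦ 1 * ((fderiv ℝ U z (1, 0) + 1 * fderiv ℝ U z (0, 1)) ^ 2
    - V z.2 * U z ^ 2) with hp1
  have he1c : Continuous e1 := continuous_inwardDensity hVd hU 1
  have he10 : ∀ z, 0 ≤ e1 z := fun z ↦ by have := hV0 z.2; positivity
  have hw : ∀ x, HasDerivAt (fun x ↦ r x - 3 * M) (1 - 2 * M / r x) x := fun x ↦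
    (hr.hasDerivAt x).sub_const _
  have hw' : Continuous fun x ↦ 1 - 2 * M / r x :=
    continuous_const.sub (continuous_const.div hr.continuous fun x ↦ (hr.pos x).ne')
  -- a bound for `V` on `[xc, x₁]`
  obtain ⟨V₁, hV₁⟩ := isCompact_Icc.exists_bound_of_continuousOn (s := Icc xc x₁) hVd.continuous.continuousOn
  have hV₁' : ∀ x ∈ Icc xc x₁, V x ≤ V₁ := fun x hx ↦ (le_abs_self _).trans (hV₁ x hx)
  -- the local `L²` bound on `[xc, x₁]`
  have hK' : ∀ T, 0 ≤ T → (∫ t in (0 : ℝ)..T, ∫ x in xc..x₁, U (t, x) ^ 2) ≤ K := by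
    intro T hT
    have h := hK T hT
    rw [show xc + (x₁ - xc) = x₁ by ring] at h
    exact (WaveEnergy.integral2_mono_left (g := fun z ↦ U z ^ 2) (hU.continuous.pow 2)
      (fun z ↦ sq_nonneg _) hT (by linarith) (by linarith)).trans h
  -- the weighted initial energy
  set Ew0 : ℝ := ∫ x in xc..(b + 1), (r x - 3 * M) * e1 (0, x) with hEw0
  refine ⟨(Ew0 + (C + 1 / 6 * V₁) * K) / (1 / 6), fun T hT R hR ↦ ?_⟩
  set R' : ℝ := max R (max x₁ (b + 1 + T)) with hR'
  have hRR' : R ≤ R' := le_max_left _ _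
  have hx₁R' : x₁ ≤ R' := (le_max_left _ _).trans (le_max_right _ _)
  have hbR' : b + 1 + T ≤ R' := (le_max_right _ _).trans (le_max_right _ _)
  -- enlarge the box to `[xc, R']`
  refine (WaveEnergy.integral2_mono_right (g := e1) he1c he10 hT hR hRR').trans ?_
  -- the identity with vanishing boundary terms
  have hid := WaveEnergy.weighted_identity_box (κ := 1) hU hV1 (by norm_num) hsol (eκ := e1) (pκ := p1)
    (fun _ ↦ rfl) (fun _ ↦ rfl) hw hw' xc R' 0 T
  have hbdry : (∫ t in (0 : ℝ)..T, ((r R' - 3 * M) * p1 (t, R') - (r xc - 3 * M) * p1 (t, xc))) = 0 := by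
    rw [intervalIntegral.integral_congr (g := fun _ ↦ (0 : ℝ)) fun t ht ↦ ?_]
    · simp
    · rw [uIcc_of_le hT] at ht
      have hy : b + 1 + |t| ≤ R' := by rw [abs_of_nonneg ht.1]; linarith [ht.2]
      simp only [hp1, hr.center, (hzero t R' hy (1, 0)).1, (hzero t R' hy (1, 0)).2,
        (hzero t R' hy (0, 1)).2]
      ring
  rw [hbdry, zero_add] at hid
  -- the weighted initial energy on `[xc, R']` is `Ew0`
  have hEw : (∫ x in xc..R', (r x - 3 * M) * e1 (0, x)) = Ew0 := by
    have hi : ∀ p q, IntervalIntegrable (fun x ↦ (r x - 3 * M) * e1 (0, x)) volume p q := fun p q ↦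
      ((hr.continuous.sub continuous_const).mul (he1c.comp (Continuous.prodMk_right 0))).intervalIntegrable _ _
    rw [hEw0, ← intervalIntegral.integral_add_adjacent_intervals (hi xc (b + 1)) (hi (b + 1) R'),
      intervalIntegral.integral_congr (a := b + 1) (b := R') (g := fun _ ↦ (0 : ℝ)) fun x hx ↦ ?_]
    · simp
    · rw [uIcc_of_le (by linarith)] at hx
      have hy : b + 1 + |(0 : ℝ)| ≤ x := by rw [abs_zero, add_zero]; exact hx.1
      simp only [he1, (hzero 0 x hy (1, 0)).1, (hzero 0 x hy (1, 0)).2, (hzero 0 x hy (0, 1)).2]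
      ring
  rw [← hEw]
  refine WaveEnergy.weighted_box_estimate_Ioo (κ := 1) hU hV1 hV0 (fun _ ↦ rfl) hw hw' le_rfl
    (by linarith) hx₁R' hT hid (fun x hx ↦ ?_) (by norm_num) (fun x hx ↦ ?_) (fun x hx ↦ ?_) hC
    (fun x hx ↦ hnear x ⟨hx.1.le, hx.2.le⟩) hV₁' (hK' T hT)
  · have := hr.strictMono.monotone hx.1
    rw [hr.center] at this
    linarith
  · have h3 : 3 * M ≤ r x := by have := hr.strictMono.monotone hx.1; rwa [hr.center] at this
    have hrx : 0 < r x := hr.pos x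
    have : 2 * M / r x ≤ 2 / 3 := by rw [div_le_iff₀ hrx]; linarith
    linarith
  · rcases hx with hx | hx
    · exact absurd hx.1 (not_lt.2 hx.2.le)
    · exact hfar x hx.1

/-- **Left quadrant bound.** The horizon-side analogue of `quadrantBound_right` for the outgoing null energy
`(ψ_t − ψ_x)² + Vψ²` over `[0, T] × [L, xc]` (weight `xc − x`). [folklore] -/
theorem quadrantBound_left (hr : IsTortoiseRadius M r xc) (hs : s ≤ 2) (hsℓ : s ≤ ℓ) :
    ∃ ρ : ℝ, 0 < ρ ∧ ∀ ψ : ℝ → ℝ → ℝ, IsRWSolution M s ℓ r ψ → ∀ a b : ℝ, a ≤ xc → xc ≤ b →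
      CauchyDataSupportedOn ψ (Icc a b) → ∀ K : ℝ,
      (∀ T, 0 ≤ T → (∫ t in (0 : ℝ)..T, ∫ x in (xc - ρ)..(xc + ρ), ψ t x ^ 2) ≤ K) →
      ∃ Q : ℝ, ∀ T, 0 ≤ T → ∀ L, L ≤ xc → (∫ t in (0 : ℝ)..T, ∫ x in L..xc,
        ((fderiv ℝ (Function.uncurry ψ) (t, x) (1, 0)
            + (-1) * fderiv ℝ (Function.uncurry ψ) (t, x) (0, 1)) ^ 2
          + linePotential M s ℓ r x * Function.uncurry ψ (t, x) ^ 2)) ≤ Q := by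
  obtain ⟨x₀, C, hx₀, hC, hfar, hnear⟩ := linePotential_repulsive_left hr hs hsℓ
  refine ⟨xc - x₀, by linarith, fun ψ hψ a b ha hb hdata K hK ↦ ?_⟩
  set V := linePotential M s ℓ r with hV
  set U := Function.uncurry ψ with hUdef
  have hV1 : ContDiff ℝ 1 V := contDiff_one_linePotential hr s ℓ
  have hVd : Differentiable ℝ V := differentiable_linePotential hr s ℓ
  have hV0 : ∀ x, 0 ≤ V x := fun x ↦ (linePotential_pos hr hsℓ x).le
  have hU : ContDiff ℝ 2 U := hψ.1
  have hsol : ∀ z : ℝ × ℝ, fderiv ℝ (fderiv ℝ U) z (1, 0) (1, 0)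
      - fderiv ℝ (fderiv ℝ U) z (0, 1) (0, 1) + V z.2 * U z = 0 := by
    rintro ⟨t, x⟩
    rw [← WaveEnergy.iteratedDeriv_two_slice_fst_eq hU, ← WaveEnergy.iteratedDeriv_two_slice_snd_eq hU]
    exact hψ.2 (t, x)
  obtain ⟨-, -, h0L, h1L⟩ := data_zero hU hdata
  have hzero := fun (τ y : ℝ) (hy : y ≤ a - 1 - |τ|) (v : ℝ × ℝ) ↦
    WaveEnergy.eq_zero_left_of_data hU hVd hV0 hsol h0L h1L hy v
  -- densities and weight
  set e1 : ℝ × ℝ → ℝ := fun z ↦ (fderiv ℝ U z (1, 0) + (-1) * fderiv ℝ U z (0, 1)) ^ 2 + V z.2 * U z ^ 2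
    with he1
  set p1 : ℝ × ℝ → ℝ := fun z ↦ (-1) * ((fderiv ℝ U z (1, 0) + (-1) * fderiv ℝ U z (0, 1)) ^ 2
    - V z.2 * U z ^ 2) with hp1
  have he1c : Continuous e1 := continuous_inwardDensity hVd hU (-1)
  have he10 : ∀ z, 0 ≤ e1 z := fun z ↦ by have := hV0 z.2; positivity
  have hw : ∀ x, HasDerivAt (fun x ↦ xc - x) (-1) x := fun x ↦ (hasDerivAt_id' x).const_sub xc
  have hw' : Continuous fun _ : ℝ ↦ (-1 : ℝ) := continuous_const
  -- a bound for `V` on `[x₀, xc]`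
  obtain ⟨V₁, hV₁⟩ := isCompact_Icc.exists_bound_of_continuousOn (s := Icc x₀ xc) hVd.continuous.continuousOn
  have hV₁' : ∀ x ∈ Icc x₀ xc, V x ≤ V₁ := fun x hx ↦ (le_abs_self _).trans (hV₁ x hx)
  -- the local `L²` bound on `[x₀, xc]`
  have hK' : ∀ T, 0 ≤ T → (∫ t in (0 : ℝ)..T, ∫ x in x₀..xc, U (t, x) ^ 2) ≤ K := by
    intro T hT
    have h := hK T hT
    rw [show xc - (xc - x₀) = x₀ by ring] at h
    exact (WaveEnergy.integral2_mono_right (g := fun z ↦ U z ^ 2) (hU.continuous.pow 2)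
      (fun z ↦ sq_nonneg _) hT (by linarith) (by linarith)).trans h
  -- the weighted initial energy
  set Ew0 : ℝ := ∫ x in (a - 1)..xc, (xc - x) * e1 (0, x) with hEw0
  refine ⟨(Ew0 + (C + 1 * V₁) * K) / 1, fun T hT L hL ↦ ?_⟩
  set L' : ℝ := min L (min x₀ (a - 1 - T)) with hL'
  have hLL' : L' ≤ L := min_le_left _ _
  have hx₀L' : L' ≤ x₀ := (min_le_right _ _).trans (min_le_left _ _)
  have haL' : L' ≤ a - 1 - T := (min_le_right _ _).trans (min_le_right _ _)
  -- enlarge the box to `[L', xc]`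
  refine (WaveEnergy.integral2_mono_left (g := e1) he1c he10 hT hLL' hL).trans ?_
  -- the identity with vanishing boundary terms
  have hid := WaveEnergy.weighted_identity_box (κ := -1) hU hV1 (by norm_num) hsol (eκ := e1) (pκ := p1)
    (fun _ ↦ rfl) (fun _ ↦ rfl) hw hw' L' xc 0 T
  have hbdry : (∫ t in (0 : ℝ)..T, ((xc - xc) * p1 (t, xc) - (xc - L') * p1 (t, L'))) = 0 := by
    rw [intervalIntegral.integral_congr (g := fun _ ↦ (0 : ℝ)) fun t ht ↦ ?_]
    · simp
    · rw [uIcc_of_le hT] at ht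
      have hy : L' ≤ a - 1 - |t| := by rw [abs_of_nonneg ht.1]; linarith [ht.2]
      simp only [hp1, sub_self, (hzero t L' hy (1, 0)).1, (hzero t L' hy (1, 0)).2,
        (hzero t L' hy (0, 1)).2]
      ring
  rw [hbdry, zero_add] at hid
  -- the weighted initial energy on `[L', xc]` is `Ew0`
  have hEw : (∫ x in L'..xc, (xc - x) * e1 (0, x)) = Ew0 := by
    have hi : ∀ p q, IntervalIntegrable (fun x ↦ (xc - x) * e1 (0, x)) volume p q := fun p q ↦
      ((continuous_const.sub continuous_id).mul (he1c.comp (Continuous.prodMk_right 0))).intervalIntegrable _ _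
    rw [hEw0, ← intervalIntegral.integral_add_adjacent_intervals (hi L' (a - 1)) (hi (a - 1) xc),
      intervalIntegral.integral_congr (a := L') (b := a - 1) (g := fun _ ↦ (0 : ℝ)) fun x hx ↦ ?_]
    · simp
    · rw [uIcc_of_le (by linarith)] at hx
      have hy : x ≤ a - 1 - |(0 : ℝ)| := by rw [abs_zero, sub_zero]; exact hx.2
      simp only [he1, (hzero 0 x hy (1, 0)).1, (hzero 0 x hy (1, 0)).2, (hzero 0 x hy (0, 1)).2]
      ring
  rw [← hEw]
  refine WaveEnergy.weighted_box_estimate_Ioo (κ := -1) hU hV1 hV0 (fun _ ↦ rfl) hw hw' hx₀L'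
    (by linarith) le_rfl hT hid (fun x hx ↦ ?_) (by norm_num) (fun x _ ↦ by norm_num) (fun x hx ↦ ?_) hC
    (fun x hx ↦ hnear x ⟨hx.1.le, hx.2.le⟩) hV₁' (hK' T hT)
  · linarith [hx.2]
  · rcases hx with hx | hx
    · exact hfar x hx.2
    · exact absurd hx.1 (not_lt.2 hx.2.le)

end RW

/-- The registered ILED integrand dominates `ψ²` on every box, for a global `C²` function. -/
private theorem integral2_sq_le_iled {ψ : ℝ → ℝ → ℝ} (hU : ContDiff ℝ 2 (Function.uncurry ψ))
    {T p q : ℝ} (hT : 0 ≤ T) (hpq : p ≤ q) :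
    (∫ t in (0 : ℝ)..T, ∫ x in p..q, ψ t x ^ 2) ≤ ∫ t in (0 : ℝ)..T, ∫ x in p..q,
      (deriv (fun τ ↦ ψ τ x) t ^ 2 + deriv (ψ t) x ^ 2 + ψ t x ^ 2) := by
  have hh : Continuous fun z : ℝ × ℝ ↦ deriv (fun τ ↦ ψ τ z.2) z.1 ^ 2 + deriv (ψ z.1) z.2 ^ 2
      + ψ z.1 z.2 ^ 2 := by
    have hfun : (fun z : ℝ × ℝ ↦ deriv (fun τ ↦ ψ τ z.2) z.1 ^ 2 + deriv (ψ z.1) z.2 ^ 2 + ψ z.1 z.2 ^ 2)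
        = fun z ↦ (fderiv ℝ (Function.uncurry ψ) z (1, 0)) ^ 2
          + (fderiv ℝ (Function.uncurry ψ) z (0, 1)) ^ 2 + Function.uncurry ψ z ^ 2 := by
      funext z
      rw [WaveEnergy.deriv_slice_fst_eq hU, WaveEnergy.deriv_slice_snd_eq hU]
      rfl
    rw [hfun]
    exact (((WaveEnergy.continuous_fderiv_apply hU (1, 0)).pow 2).add
      ((WaveEnergy.continuous_fderiv_apply hU (0, 1)).pow 2)).add (hU.continuous.pow 2)
  exact WaveEnergy.integral2_mono_on_Ioo (g := fun z : ℝ × ℝ ↦ ψ z.1 z.2 ^ 2)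
    (h := fun z : ℝ × ℝ ↦ deriv (fun τ ↦ ψ τ z.2) z.1 ^ 2 + deriv (ψ z.1) z.2 ^ 2 + ψ z.1 z.2 ^ 2)
    (hU.continuous.pow 2) hh hT hpq fun t _ x _ ↦ le_add_of_nonneg_left (by positivity)

/-- **Registered sub-goal `stub_compactExhaustionOfLocalDecay` of stub H4 (`stub_outgoingEnergyExhaustion`)**
(crux stmt-FinalStateConjecture-14075, line `isolated-kerr-connected-hull`): integrated local energy decay on
compact tortoise intervals for compactly supported Regge–Wheeler data (the hypothesis) implies
outgoing-energy exhaustion for such data — the forward channel energy of `ψ(T + ·)` through the bare light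
cone about `xc` tends to the total energy as `T → +∞`. [folklore] -/
theorem stub_compactExhaustionOfLocalDecay : (∀ M : ℝ, 0 < M → ∀ (r : ℝ → ℝ) (xc : ℝ),
    ReggeWheeler.IsTortoiseRadius M r xc → ∀ (s ℓ : ℕ), s ≤ 2 → s ≤ ℓ → ∀ ρ : ℝ, 0 < ρ → ∃ C : ℝ, 0 ≤ C ∧
    ∀ ψ : ℝ → ℝ → ℝ, ReggeWheeler.IsRWSolution M s ℓ r ψ →
    ReggeWheeler.totalEnergy (ReggeWheeler.linePotential M s ℓ r) ψ 0 < ⊤ →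
    (∃ a b : ℝ, ReggeWheeler.CauchyDataSupportedOn ψ (Set.Icc a b)) → ∀ T : ℝ, 0 ≤ T →
    (∫ t in (0:ℝ)..T, ∫ x in (xc - ρ)..(xc + ρ),
      (deriv (fun τ ↦ ψ τ x) t ^ 2 + deriv (ψ t) x ^ 2 + ψ t x ^ 2))
      ≤ C * (ReggeWheeler.totalEnergy (ReggeWheeler.linePotential M s ℓ r) ψ 0).toReal) →
    ∀ M : ℝ, 0 < M → ∀ (r : ℝ → ℝ) (xc : ℝ), ReggeWheeler.IsTortoiseRadius M r xc → ∀ (s ℓ : ℕ),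
    s ≤ 2 → s ≤ ℓ → ∀ ψ : ℝ → ℝ → ℝ, ReggeWheeler.IsRWSolution M s ℓ r ψ →
    ReggeWheeler.totalEnergy (ReggeWheeler.linePotential M s ℓ r) ψ 0 < ⊤ →
    (∃ a b : ℝ, ReggeWheeler.CauchyDataSupportedOn ψ (Set.Icc a b)) →
    Filter.Tendsto (fun T ↦ ReggeWheeler.channelEnergy (ReggeWheeler.linePotential M s ℓ r) xc 0
      (fun t x ↦ ψ (T + t) x) Filter.atTop) Filter.atTop
      (nhds (ReggeWheeler.totalEnergy (ReggeWheeler.linePotential M s ℓ r) ψ 0)) := by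
  intro hILED M hM r xc hr s ℓ hs hsℓ ψ hψ hE hab
  obtain ⟨a, b, hab'⟩ := hab
  -- enlarge the support interval so that it contains the centre
  have hdata : CauchyDataSupportedOn ψ (Icc (min a xc) (max b xc)) := fun x hx ↦
    hab' x fun h ↦ hx ⟨(min_le_left _ _).trans h.1, h.2.trans (le_max_left _ _)⟩
  obtain ⟨ρR, hρR, HR⟩ := RW.quadrantBound_right hr hs hsℓ
  obtain ⟨ρL, hρL, HL⟩ := RW.quadrantBound_left hr hs hsℓ
  obtain ⟨CR, -, hCR⟩ := hILED M hM r xc hr s ℓ hs hsℓ ρR hρR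
  obtain ⟨CL, -, hCL⟩ := hILED M hM r xc hr s ℓ hs hsℓ ρL hρL
  have hKR : ∀ T, 0 ≤ T → (∫ t in (0 : ℝ)..T, ∫ x in (xc - ρR)..(xc + ρR), ψ t x ^ 2)
      ≤ CR * (totalEnergy (linePotential M s ℓ r) ψ 0).toReal := fun T hT ↦
    (integral2_sq_le_iled hψ.1 hT (by linarith)).trans (hCR ψ hψ hE ⟨a, b, hab'⟩ T hT)
  have hKL : ∀ T, 0 ≤ T → (∫ t in (0 : ℝ)..T, ∫ x in (xc - ρL)..(xc + ρL), ψ t x ^ 2)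
      ≤ CL * (totalEnergy (linePotential M s ℓ r) ψ 0).toReal := fun T hT ↦
    (integral2_sq_le_iled hψ.1 hT (by linarith)).trans (hCL ψ hψ hE ⟨a, b, hab'⟩ T hT)
  obtain ⟨QR, hQR⟩ := HR ψ hψ _ _ (min_le_right _ _) (le_max_right _ _) hdata _ hKR
  obtain ⟨QL, hQL⟩ := HL ψ hψ _ _ (min_le_right _ _) (le_max_right _ _) hdata _ hKL
  exact RW.tendsto_channelEnergy_shift_of_quadrantBounds (RW.differentiable_linePotential hr s ℓ)
    (fun x ↦ (RW.linePotential_pos hr hsℓ x).le) hψ hQR hQL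

end

end Summit.FinalStateConjecture.FinalStateConjecture.Theorems
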